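import Summits.BirchSwinnertonDyer.Rank1Residual.X11a.OrdinaryLineKummer
import Summits.BirchSwinnertonDyer.Rank1Residual.X11a.SelmerCompanionTateLine
import Summits.BirchSwinnertonDyer.Rank1Residual.X11a.PartnerOrdinary
import HarnessLib

/-!
# Route (3e) SELMER COMPANION, XVIII-c: at `v = p` with a MULTIPLICATIVE curve and a GOOD partner,
# a transported Selmer cocycle is kernel-of-reduction valued modulo a coboundary
# (class X11a = N7; cell `b2b-bsdres`, unit `b2b-bsdres-x11a`, gen 29)

HONEST FRAMING (run/shared/lean/b2b/bsd-rank1-residual/, verbatim in every file): the goal of the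
cell is to DELETE the COMBINATION-SHAPED residual classes of the Birch–Swinnerton-Dyer formula for
ALL analytic-rank `≤ 1` elliptic curves over `ℚ` — "full BSD formula for every rank `≤ 1` curve in
class `C`" assembled STRICTLY from published theorems — so that the rank-`≤ 1` remainder becomes
exactly the CONSTRUCTION-SHAPED classes, which are TYPED (missing-input `Prop`s), NOT attempted.
This is not "finishing BSD". CLASS-OWNERS.md: research routes; NO CLAIM BEYOND STATED CLASSES.
THEOREMS ONLY; nothing booked; no label moves. CONDITIONAL on the PUBLISHED named fact
`Silverman1994_thmV53_corV54_tateUniformisation` (A41, `hU`) where it is a hypothesis.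

## What (`exists_kernelValued_of_mult_of_good_at_p`)

The E-SIDE of file VIII (`X11a/SelmerCompanionAtP.lean`, gen 27), isolated and freed of the
non-split hypothesis: `E = W`, `A` globally minimal over `ℚ`, `p` odd, `v ∋ p`, `θ : E[p] ≃ A[p]`
`Γ_ℚ`-equivariant, `E` MULTIPLICATIVE at `p` (split or not), `A` GOOD at `p`. For every continuous
cocycle `φ : Γ_ℚ → E[p]` whose class is Selmer at `v`, the transported restriction
`σ ↦ θ φ(res σ) ∈ A(K̄_v)` is `f σ + (σ b₀ - b₀)` with `b₀ ∈ A[p]` and `f` a continuous crossed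
homomorphism `Γ_{ℚ_v} → A(K̄_v)` with values in the kernel-of-reduction LINE `C = A₁ ∩ A[p]`
(`p f = 0`, `f σ ∈ A₁(K̄_v)`), together with the twist datum (α): an inertia element `ι` and a
non-zero `x₁ ∈ C` with `ι x₁ = 2 x₁`. PROOF (as in file VIII): by file VIII-a (A41) `φ(res σ) =
Ψ(ζ_σ) + (σT₀ - T₀)` with `ζ_σ ∈ μ_p`; an inertia element `ι` with `ι ζ = ζ²` fixes `t = √γ`
(`X2.…inertia_fix_sqrt_gamma`), so acts by `2` on `x₁ = θΨ(ζ₁)`, while local inertia acts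
trivially on the reduction (file VII): `x₁ = ιx₁ - x₁ ∈ A₁`; and `f σ = θΨ(ζ_σ) ∈ ℤ x₁`. Used by
file XIX (the comparison index and the strictness at `p` for a SPLIT `E` with an anomalous good
partner).

References: [SilvermanATAEC1994] V.5.2 (c), 5.3, 5.4; [SilvermanAEC2009] VII.2.1;
[Serre1972] §1.11–1.12; HOME/b2b-bsdres-x11a/REPORT-g29.md.
-/

set_option autoImplicit false

noncomputable section

open scoped Classical NNReal

open WeierstrassCurve Literature.NumberTheory.EllipticCurves
  Literature.NumberTheory.GaloisRepresentations Field NumberField IsDedekindDomain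
  IsDedekindDomain.HeightOneSpectrum Literature.NumberTheory.EllipticCurves.FormalGroupChart
  Literature.NumberTheory.EllipticCurves.Rank1Residual
  Literature.NumberTheory.EllipticCurves.Rank1Residual.Typed

namespace Summit.BirchSwinnertonDyer.Rank1Residual.X11a.SelmerCompanion

variable (W A : WeierstrassCurve ℚ) [W.IsElliptic] [W.IsGloballyMinimal] [A.IsElliptic]
  [A.IsGloballyMinimal] (p : ℕ) [hp : Fact p.Prime]
  {v : HeightOneSpectrum (𝓞 ℚ)}
  {w : Valuation (AlgebraicClosure (v.adicCompletion ℚ)) ℝ≥0}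
  (hw : ∀ x, (w x : ℝ) =
    spectralNorm (v.adicCompletion ℚ) (AlgebraicClosure (v.adicCompletion ℚ)) x)

include hw in
omit [A.IsElliptic] in
set_option maxHeartbeats 800000 in
-- one long proof (the transport of the Tate line); not a search
/-- **The transported Selmer cocycle at `v = p` is `C`-valued modulo a coboundary** (`E = W`
MULTIPLICATIVE at `p`, `A` GOOD at `p`, both globally minimal over `ℚ`, `p` odd, `θ : E[p] ≃ A[p]`
`Γ_ℚ`-equivariant; `w` the spectral valuation of `K̄_v`): for a continuous cocycle `φ` of `E[p]` whose
class is Selmer at `v`, there are a continuous crossed homomorphism `f : Γ_{ℚ_v} → A(K̄_v)` with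
`p f = 0` and values in the kernel of reduction `A₁(K̄_v)`, and a `p`-torsion point `b₀`, with
`θ φ(res σ) = f σ + (σ b₀ - b₀)`; and the line `C = A₁ ∩ A[p]` carries the twist (α) (an `ι` acting by
`2` on a non-zero `p`-torsion point of `A₁`). Granted A41 (`hU`). See the module docstring.
[cite: SilvermanATAEC1994, Ch. V Lemma 5.2 (c), Thm. 5.3, Cor. 5.4]
[cite: SilvermanAEC2009, Prop. VII.2.1] -/
theorem exists_kernelValued_of_mult_of_good_at_p
    (hU : Silverman1994_thmV53_corV54_tateUniformisation.{0}) (hp2 : p ≠ 2)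
    (θ : geomTorsion W (p : ℤ) ≃+ geomTorsion A (p : ℤ))
    (hθ : ∀ (σ : absoluteGaloisGroup ℚ) (P : geomTorsion W (p : ℤ)), θ (σ • P) = σ • θ P)
    (hpv : (p : 𝓞 ℚ) ∈ v.asIdeal)
    (hmult : W.HasMultiplicativeReductionAtPrime p) (hA : A.HasGoodReductionAtPrime p)
    [hV : (A.baseChange (AlgebraicClosure (v.adicCompletion ℚ))).IsIntegral w.integer]
    (φ : contOneCocycles (discreteTopRep (absoluteGaloisGroup ℚ) (geomTorsion W (p : ℤ))))
    (hc : oneCocycleClass _ φ ∈ selmerLocalKer W (v.adicCompletion ℚ) (p : ℤ)) :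
    ∃ (f : absoluteGaloisGroup (v.adicCompletion ℚ) → localPoints A (v.adicCompletion ℚ))
      (b₀ : localPoints A (v.adicCompletion ℚ)),
      Continuous f ∧ (∀ σ τ, f (σ * τ) = f σ + σ • f τ) ∧ (∀ σ, (p : ℤ) • f σ = 0) ∧
      (∀ σ, (f σ : (A.baseChange (AlgebraicClosure (v.adicCompletion ℚ))).toAffine.Point) ∈
        kernel w (A.baseChange (AlgebraicClosure (v.adicCompletion ℚ)))) ∧
      (p : ℤ) • b₀ = 0 ∧
      (∀ σ : absoluteGaloisGroup (v.adicCompletion ℚ), pointsMap A (v.adicCompletion ℚ)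
        ((θ (φ.1 (resGal (K := ℚ) (v.adicCompletion ℚ) σ)) : geomTorsion A (p : ℤ)) : geomPoints A)
          = f σ + (σ • b₀ - b₀)) ∧
      ∃ (ι : absoluteGaloisGroup (v.adicCompletion ℚ)) (x₁ : localPoints A (v.adicCompletion ℚ)),
        (p : ℤ) • x₁ = 0 ∧
        (x₁ : (A.baseChange (AlgebraicClosure (v.adicCompletion ℚ))).toAffine.Point) ∈
          kernel w (A.baseChange (AlgebraicClosure (v.adicCompletion ℚ))) ∧
        x₁ ≠ 0 ∧ ι • x₁ = (2 : ℤ) • x₁ := by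
  have hpp : p.Prime := hp.out
  haveI : NeZero p := ⟨hpp.ne_zero⟩
  -- NB: no `CharZero ℚ_v` instance (it would re-route `Algebra ℚ ℚ_v`).
  haveI : NeZero ((p : ℕ) : v.adicCompletion ℚ) := ⟨by
    rw [← map_natCast (algebraMap ℚ (v.adicCompletion ℚ))]
    exact (map_ne_zero _).mpr (Nat.cast_ne_zero.mpr hpp.ne_zero)⟩
  have hn : (p : ℤ) ≠ 0 := by exact_mod_cast hpp.ne_zero
  obtain ⟨𝔐, h𝔐⟩ := v.localPrimesAbove_nonempty
  have hϖ : Irreducible ((p : ℕ) : v.adicCompletionIntegers ℚ) :=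
    irreducible_natCast_adicCompletionIntegers_rat hpv
  -- the curve `E` is multiplicative at `v`; twisted Tate parametrisation (A41)
  have hW : W.HasMultiplicativeReductionAt v := by
    have hvp : (Rat.HeightOneSpectrum.primesEquiv v : ℕ) = p :=
      Rat.HeightOneSpectrum.primesEquiv_eq_of_natCast_mem v hpp hpv
    have h := W.hasMultiplicativeReductionAtPrime_iff_hasMultiplicativeReductionAt_ringOfIntegers v
    subst hvp
    exact h.mp hmult
  -- the E-SIDE (file VIII-a): `φ(res σ) = Ψ(ζ_σ) + (σT - T)` in `E(K̄_v)`
  obtain ⟨q, t, Φ, hq0, hq1, ht2, hker, hequiv₀, ζf, T, hζσ, hTp, hφT⟩ :=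
    exists_cocycle_eq_tate_rootOfUnity W v hU hp2 hW φ hc
  -- the sign `ε(σ)`
  obtain ⟨ε, hε_of_fix, hε_of_not⟩ : ∃ ε : (absoluteGaloisGroup (v.adicCompletion ℚ)) → ℤ,
      (∀ σ, Field.absoluteGaloisGroup.toAlgEquiv (v.adicCompletion ℚ) σ t = t → ε σ = 1) ∧
        (∀ σ, Field.absoluteGaloisGroup.toAlgEquiv (v.adicCompletion ℚ) σ t ≠ t → ε σ = -1) :=
    ⟨fun σ ↦ if Field.absoluteGaloisGroup.toAlgEquiv (v.adicCompletion ℚ) σ t = t then 1 else -1,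
      fun σ h ↦ if_pos h, fun σ h ↦ if_neg h⟩
  have hequiv : ∀ (σ : absoluteGaloisGroup (v.adicCompletion ℚ))
      (u : (AlgebraicClosure (v.adicCompletion ℚ))ˣ),
      σ • Φ (Additive.ofMul u) = (ε σ) • Φ (Additive.ofMul (Units.map
        (absoluteGaloisGroup.toAlgEquiv _ σ : AlgebraicClosure (v.adicCompletion ℚ) →*
          AlgebraicClosure (v.adicCompletion ℚ)) u)) := by
    intro σ u
    rw [hequiv₀ σ u]
    by_cases h : Field.absoluteGaloisGroup.toAlgEquiv (v.adicCompletion ℚ) σ t = t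
    · rw [if_pos h, hε_of_fix σ h]
    · rw [if_neg h, hε_of_not σ h]
  -- a primitive `p`-th root of unity `ζ₁`; an INERTIA element `ι` with `ι ζ₁ = ζ₁²` fixing `t`
  obtain ⟨ζ₁, hζ₁⟩ := HasEnoughRootsOfUnity.prim (M := AlgebraicClosure (v.adicCompletion ℚ)) (n := p)
  have h2p : Nat.Coprime 2 p := (Nat.coprime_primes Nat.prime_two hpp).mpr (Ne.symm hp2)
  obtain ⟨ι, hιI, hιζ⟩ := exists_mem_inertia_smul_eq_of_isPrimitiveRoot hw h𝔐 hpv hϖ 0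
    (ζ := ζ₁) (μ := ζ₁ ^ 2) (by rwa [zero_add, pow_one]) (by
      rw [zero_add, pow_one]; exact hζ₁.pow_of_coprime 2 h2p)
  have hιt : Field.absoluteGaloisGroup.toAlgEquiv (v.adicCompletion ℚ) ι t = t := by
    have hι' := hιI
    rw [HeightOneSpectrum.inertia_eq_absInertia hw h𝔐] at hι'
    exact X2.GreenbergVatsalTateDatumRat.inertia_fix_sqrt_gamma W hp2 hmult hpv t ht2 ι hι'
  -- roots of unity as `p`-torsion points of `E(K̄_v)`, and the transported map `jA` into `A(K̄_v)`
  have hmemζ : ∀ ζ : rootsOfUnity p (AlgebraicClosure (v.adicCompletion ℚ)),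
      Φ (Additive.ofMul (ζ : (AlgebraicClosure (v.adicCompletion ℚ))ˣ)) ∈
        AddSubgroup.torsionBy (localPoints W (v.adicCompletion ℚ)) (p : ℤ) := fun ζ ↦
    (Submodule.mem_torsionBy_iff _ _).mpr
      (W.zsmul_map_ofMul_eq_zero_of_pow_eq_one v Φ ((mem_rootsOfUnity _ _).mp ζ.2))
  set e := W.torsionPointsEquiv (p : ℤ) (E := (v.adicCompletion ℚ)) hn with he
  set TΦ : Additive (rootsOfUnity p (AlgebraicClosure (v.adicCompletion ℚ))) →+
      AddSubgroup.torsionBy (localPoints W (v.adicCompletion ℚ)) (p : ℤ) :=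
    AddMonoidHom.codRestrict (Φ.comp (rootsOfUnity p
      (AlgebraicClosure (v.adicCompletion ℚ))).subtype.toAdditive) _
      (fun x ↦ hmemζ (Additive.toMul x)) with hTΦ
  have hTΦ_apply : ∀ ζ : rootsOfUnity p (AlgebraicClosure (v.adicCompletion ℚ)),
      ((TΦ (Additive.ofMul ζ) : AddSubgroup.torsionBy (localPoints W (v.adicCompletion ℚ)) (p : ℤ)) :
        localPoints W (v.adicCompletion ℚ)) =
        Φ (Additive.ofMul (ζ : (AlgebraicClosure (v.adicCompletion ℚ))ˣ)) := fun ζ ↦ rfl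
  set jA : Additive (rootsOfUnity p (AlgebraicClosure (v.adicCompletion ℚ))) →+
      localPoints A (v.adicCompletion ℚ) :=
    (pointsMap A (v.adicCompletion ℚ)).comp ((geomTorsion A (p : ℤ)).subtype.comp
      (θ.toAddMonoidHom.comp (e.symm.toAddMonoidHom.comp TΦ))) with hjAdef
  have hjA : ∀ ζ : rootsOfUnity p (AlgebraicClosure (v.adicCompletion ℚ)),
      jA (Additive.ofMul ζ) = pointsMap A (v.adicCompletion ℚ)
        ((θ (e.symm (TΦ (Additive.ofMul ζ))) : geomTorsion A (p : ℤ)) : geomPoints A) := fun ζ ↦ rfl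
  -- the Galois action on roots of unity, as units
  have hσζ : ∀ (σ : absoluteGaloisGroup (v.adicCompletion ℚ))
      (ζ : rootsOfUnity p (AlgebraicClosure (v.adicCompletion ℚ))),
      Units.map (absoluteGaloisGroup.toAlgEquiv _ σ : AlgebraicClosure (v.adicCompletion ℚ) →*
        AlgebraicClosure (v.adicCompletion ℚ)) (ζ : (AlgebraicClosure (v.adicCompletion ℚ))ˣ) =
        ((σ • ζ : rootsOfUnity p (AlgebraicClosure (v.adicCompletion ℚ))) :
          (AlgebraicClosure (v.adicCompletion ℚ))ˣ) := by
    intro σ ζ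
    apply Units.ext
    rw [Units.coe_map, MonoidHom.coe_coe, ← Field.absoluteGaloisGroup.smul_def,
      absoluteGaloisGroup.coe_smul_rootsOfUnity, Units.coe_smul]
  -- EQUIVARIANCE of `jA` up to the sign: `σ • jA ζ = ε(σ) • jA (σ ζ)`
  have hjAσ : ∀ (σ : absoluteGaloisGroup (v.adicCompletion ℚ))
      (ζ : rootsOfUnity p (AlgebraicClosure (v.adicCompletion ℚ))),
      σ • jA (Additive.ofMul ζ) = (ε σ) • jA (Additive.ofMul (σ • ζ)) := by
    intro σ ζ
    have hT : σ • TΦ (Additive.ofMul ζ) = (ε σ) • TΦ (Additive.ofMul (σ • ζ)) := by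
      apply Subtype.ext
      rw [AddSubgroup.torsionBy.coe_smul, hTΦ_apply, hequiv σ, hσζ, AddSubgroupClass.coe_zsmul,
        hTΦ_apply]
    rw [hjA, hjA, ← map_zsmul (pointsMap A (v.adicCompletion ℚ)), ← AddSubgroupClass.coe_zsmul,
      ← map_zsmul θ, ← map_zsmul e.symm, ← hT, W.torsionPointsEquiv_symm_smul (p : ℤ) hn σ, hθ,
      Literature.NumberTheory.EllipticCurves.AddSubgroup.torsionBy.coe_smul, pointsMap_smul]
  -- powers: `jA (ζ ^ k) = k • jA ζ`
  have hjApow : ∀ (ζ : rootsOfUnity p (AlgebraicClosure (v.adicCompletion ℚ))) (k : ℕ),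
      jA (Additive.ofMul (ζ ^ k)) = k • jA (Additive.ofMul ζ) := fun ζ k ↦ by
    rw [ofMul_pow, map_nsmul]
  -- the point `x₁ = jA ζ₁`
  set ζ₁r : rootsOfUnity p (AlgebraicClosure (v.adicCompletion ℚ)) :=
    rootsOfUnity.mkOfPowEq ζ₁ hζ₁.pow_eq_one with hζ₁r
  have hζ₁r_coe : ((ζ₁r : (AlgebraicClosure (v.adicCompletion ℚ))ˣ) :
      AlgebraicClosure (v.adicCompletion ℚ)) = ζ₁ := rfl
  set x₁ : localPoints A (v.adicCompletion ℚ) := jA (Additive.ofMul ζ₁r) with hx₁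
  -- `ι` acts on `x₁` by `2`
  have hιζ₁r : ι • ζ₁r = ζ₁r ^ 2 := by
    apply Subtype.ext; apply Units.ext
    rw [absoluteGaloisGroup.coe_smul_rootsOfUnity, Units.coe_smul, hζ₁r_coe, hιζ]
    rfl
  have hιx₁ : ι • x₁ = (2 : ℤ) • x₁ := by
    rw [hx₁, hjAσ, hε_of_fix ι hιt, one_zsmul, hιζ₁r, hjApow, ← natCast_zsmul]
    rfl
  -- `x₁ ≠ 0`
  have hx₁0 : x₁ ≠ 0 := by
    intro h0
    have h1 : Φ (Additive.ofMul (ζ₁r : (AlgebraicClosure (v.adicCompletion ℚ))ˣ)) ≠ 0 :=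
      W.map_ofMul_ne_zero_of_pow_eq_one v hq0 hq1 Φ hker ((mem_rootsOfUnity _ _).mp ζ₁r.2)
        (by
          intro h1
          have h2 := congrArg (fun u : (AlgebraicClosure (v.adicCompletion ℚ))ˣ ↦
            (u : AlgebraicClosure (v.adicCompletion ℚ))) h1
          simp only [hζ₁r_coe, Units.val_one] at h2
          exact hζ₁.ne_one hpp.one_lt h2)
    apply h1
    rw [← hTΦ_apply]
    have h3 : (θ (e.symm (TΦ (Additive.ofMul ζ₁r))) : geomTorsion A (p : ℤ)) = 0 := by
      apply Subtype.ext
      apply pointsMapOfEmb_injective A (closureEmb (K := ℚ) (v.adicCompletion ℚ))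
      change pointsMap A (v.adicCompletion ℚ) _ = pointsMap A (v.adicCompletion ℚ) _
      rw [← hjA, ZeroMemClass.coe_zero, map_zero]
      exact h0
    rw [map_eq_zero_iff θ θ.injective, map_eq_zero_iff e.symm e.symm.injective] at h3
    rw [h3, ZeroMemClass.coe_zero]
  -- `x₁` is `p`-torsion and lies in the kernel of reduction of `A ⊗ K̄_v`
  have hjAp : ∀ ζ : rootsOfUnity p (AlgebraicClosure (v.adicCompletion ℚ)),
      (p : ℤ) • jA (Additive.ofMul ζ) = 0 := by
    intro ζ
    rw [hjA, ← map_zsmul, ← AddSubgroupClass.coe_zsmul]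
    have h0 : ((p : ℤ) • θ (e.symm (TΦ (Additive.ofMul ζ))) : geomTorsion A (p : ℤ)) = 0 :=
      Subtype.ext (by
        rw [AddSubgroupClass.coe_zsmul, ZeroMemClass.coe_zero]
        exact (mem_geomTorsion_iff A _ _).mp (θ (e.symm (TΦ (Additive.ofMul ζ)))).2)
    rw [h0, ZeroMemClass.coe_zero, map_zero]
  have hΔA : ¬ (p : ℤ) ∣ minimalDiscriminantInt A :=
    A.not_dvd_minimalDiscriminantInt_of_hasGoodReductionAtPrime' p hA
  have hx₁ker : (x₁ : (A.baseChange (AlgebraicClosure (v.adicCompletion ℚ))).toAffine.Point) ∈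
      kernel w (A.baseChange (AlgebraicClosure (v.adicCompletion ℚ))) := by
    have h1 : ι • x₁ - x₁ = x₁ := by rw [hιx₁, two_zsmul, add_sub_cancel_right]
    have h : ((ι • x₁ - x₁ : localPoints A (v.adicCompletion ℚ)) :
        (A.baseChange (AlgebraicClosure (v.adicCompletion ℚ))).toAffine.Point) ∈
        kernel w (A.baseChange (AlgebraicClosure (v.adicCompletion ℚ))) :=
      OrdinaryLine.smul_sub_mem_kernel_of_mem_inertia hw A hpv hΔA h𝔐 hιI x₁
    rwa [h1] at h
  -- in `E[p](ℚ̄)`-coordinates: `φ(res σ) = e⁻¹ TΦ(ζ_σ) + (res σ • T₀ - T₀)`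
  set Tt : AddSubgroup.torsionBy (localPoints W (v.adicCompletion ℚ)) (p : ℤ) :=
    ⟨T, (Submodule.mem_torsionBy_iff _ _).mpr hTp⟩ with hTt
  set T₀ : geomTorsion W (p : ℤ) := e.symm Tt with hT₀
  have hT₀ : pointsMap W (v.adicCompletion ℚ) (T₀ : geomPoints W) = T := by
    rw [hT₀, he, W.pointsMap_torsionPointsEquiv_symm (p : ℤ) hn Tt]
  set ζr : (absoluteGaloisGroup (v.adicCompletion ℚ)) →
      rootsOfUnity p (AlgebraicClosure (v.adicCompletion ℚ)) :=
    fun σ ↦ ⟨ζf σ, (mem_rootsOfUnity _ _).mpr (hζσ σ)⟩ with hζr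
  have hφσ : ∀ σ : (absoluteGaloisGroup (v.adicCompletion ℚ)), φ.1 (resGal (K := ℚ)
      (v.adicCompletion ℚ) σ) =
      e.symm (TΦ (Additive.ofMul (ζr σ))) + (resGal (K := ℚ)
          (v.adicCompletion ℚ) σ • T₀ - T₀) := by
    intro σ
    apply Subtype.ext
    apply pointsMapOfEmb_injective W (closureEmb (K := ℚ) (v.adicCompletion ℚ))
    change pointsMap W (v.adicCompletion ℚ) _ = pointsMap W (v.adicCompletion ℚ) _
    rw [hφT σ, AddSubgroup.coe_add, AddSubgroup.coe_sub, map_add (pointsMap W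
        (v.adicCompletion ℚ)),
      map_sub (pointsMap W (v.adicCompletion ℚ)),
      Literature.NumberTheory.EllipticCurves.AddSubgroup.torsionBy.coe_smul, pointsMap_smul, hT₀,
      he, W.pointsMap_torsionPointsEquiv_symm (p : ℤ) hn, hTΦ_apply]
  -- the transported cocycle, minus the coboundary of `b₀ = θ T₀`, is `jA (ζ_σ)`
  set b₀ : localPoints A (v.adicCompletion ℚ) :=
    pointsMap A (v.adicCompletion ℚ) ((θ T₀ : geomTorsion A (p : ℤ)) : geomPoints A) with hb₀
  set f : absoluteGaloisGroup (v.adicCompletion ℚ) → localPoints A (v.adicCompletion ℚ) :=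
    fun σ ↦ pointsMap A (v.adicCompletion ℚ)
      ((θ (φ.1 (resGal (K := ℚ) (v.adicCompletion ℚ) σ)) : geomTorsion A (p : ℤ)) : geomPoints A)
      - (σ • b₀ - b₀) with hf
  have hθpt : ∀ (σ : absoluteGaloisGroup (v.adicCompletion ℚ)) (P : geomTorsion W (p : ℤ)),
      pointsMap A (v.adicCompletion ℚ) ((θ (resGal (K := ℚ) (v.adicCompletion ℚ) σ • P) :
        geomTorsion A (p : ℤ)) : geomPoints A) =
        σ • pointsMap A (v.adicCompletion ℚ) ((θ P : geomTorsion A (p : ℤ)) : geomPoints A) := by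
    intro σ P
    rw [hθ, Literature.NumberTheory.EllipticCurves.AddSubgroup.torsionBy.coe_smul, pointsMap_smul]
  have hfj : ∀ σ, f σ = jA (Additive.ofMul (ζr σ)) := by
    intro σ
    rw [hf, hjA]
    dsimp only
    rw [hφσ σ, map_add, map_sub, AddSubgroup.coe_add, AddSubgroup.coe_sub, map_add, map_sub,
      hθpt, hb₀]
    abel
  have hfc : Continuous f := by
    refine Continuous.sub ?_ ((continuous_smul_localPoints A (v.adicCompletion ℚ) b₀).sub
      continuous_const)
    exact (continuous_of_discreteTopology (f := fun P : geomTorsion W (p : ℤ) ↦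
      pointsMap A (v.adicCompletion ℚ) ((θ P : geomTorsion A (p : ℤ)) : geomPoints A))).comp
      (φ.1.continuous.comp (resGal (K := ℚ) (v.adicCompletion ℚ)).continuous)
  have hcoc : ∀ g h : absoluteGaloisGroup ℚ, φ.1 (g * h) = φ.1 g + g • φ.1 h := fun g h ↦ φ.2 g h
  have hf1 : ∀ σ τ, f (σ * τ) = f σ + σ • f τ := by
    intro σ τ
    rw [hf]
    dsimp only
    rw [map_mul, hcoc, map_add, AddSubgroup.coe_add, map_add, hθpt, mul_smul, smul_sub, smul_sub]
    generalize σ • τ • b₀ = Z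
    generalize σ • b₀ = V
    generalize σ • pointsMap A (v.adicCompletion ℚ) ((θ (φ.1 (resGal (K := ℚ)
      (v.adicCompletion ℚ) τ)) : geomTorsion A (p : ℤ)) : geomPoints A) = Y
    abel
  have hfp : ∀ σ, (p : ℤ) • f σ = 0 := fun σ ↦ by rw [hfj]; exact hjAp _
  have hfk : ∀ σ, (f σ : (A.baseChange (AlgebraicClosure (v.adicCompletion ℚ))).toAffine.Point) ∈
      kernel w (A.baseChange (AlgebraicClosure (v.adicCompletion ℚ))) := by
    intro σ
    obtain ⟨k, -, hk⟩ := hζ₁.eq_pow_of_pow_eq_one (ξ := (ζf σ : AlgebraicClosure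
      (v.adicCompletion ℚ))) (by rw [← Units.val_pow_eq_pow_val, hζσ σ, Units.val_one])
    have hζk : ζr σ = ζ₁r ^ k := by
      apply Subtype.ext; apply Units.ext
      change (ζf σ : AlgebraicClosure (v.adicCompletion ℚ)) = ((ζ₁r ^ k : rootsOfUnity p _) :
        (AlgebraicClosure (v.adicCompletion ℚ))ˣ)
      rw [SubmonoidClass.coe_pow, Units.val_pow_eq_pow_val, hζ₁r_coe, hk]
    have hfσ : f σ = k • x₁ := by rw [hfj, hζk, hjApow]
    have h2 : ((k • x₁ : localPoints A (v.adicCompletion ℚ)) :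
        (A.baseChange (AlgebraicClosure (v.adicCompletion ℚ))).toAffine.Point) ∈
        kernel w (A.baseChange (AlgebraicClosure (v.adicCompletion ℚ))) :=
      (kernel w (A.baseChange (AlgebraicClosure (v.adicCompletion ℚ)))).nsmul_mem hx₁ker k
    rw [hfσ]
    assumption
  have hb₀p : (p : ℤ) • b₀ = 0 := by
    have h0 : ((p : ℤ) • θ T₀ : geomTorsion A (p : ℤ)) = 0 :=
      Subtype.ext (by
        rw [AddSubgroupClass.coe_zsmul, ZeroMemClass.coe_zero]
        exact (mem_geomTorsion_iff A _ _).mp (θ T₀).2)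
    rw [hb₀, ← map_zsmul, ← AddSubgroupClass.coe_zsmul, h0, ZeroMemClass.coe_zero, map_zero]
  exact ⟨f, b₀, hfc, hf1, hfp, hfk, hb₀p, fun σ ↦ by rw [hf]; dsimp only; abel,
    ι, x₁, hjAp ζ₁r, hx₁ker, hx₁0, hιx₁⟩

end Summit.BirchSwinnertonDyer.Rank1Residual.X11a.SelmerCompanion

end
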